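import Literature.Analysis.FluidPDE.PassiveScalarDiagEnergyEquality
import HarnessLib

/-!
# Linear-in-time `L²` growth of weak diagonal-diffusion passive scalars under an `L²`-bounded source

Analysis/FluidPDE proof-support file (everything proved). For a weak solution `θ` of
`∂ₜθ + u·∇θ = κ ∑ᵢ aᵢ ∂ᵢ∂ᵢθ + s` on `T^d × [0,T)` (`Torus.IsWeakScalarTransportDiagForcedOn`) with
`κ > 0`, `aᵢ > 0`, `θ₀ ∈ L²`, a bounded (weakly divergence-free) drift and a source with
`‖s(t)‖_{L²} ≤ M` for a.e. `t`, the energy EQUALITY of Bonicatto–Ciampa–Crippa 2024 (Thm. 3.3 /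
Remark 3.4; the tree's `IsWeakScalarTransportDiagForcedOn.energy_eq`) gives the classical a priori
bound

  `‖θ(t)‖_{L²} ≤ ‖θ₀‖_{L²} + M t` for a.e. `t ∈ (0,T)`

(`IsWeakScalarTransportDiagForcedOn.ae_sqrt_integral_sq_le`): the transport term does no work, the
dissipation has a sign, and the work of the source is at most `‖s‖ ‖θ‖`. The passage from the
integral inequality `Y(t) ≤ m² + 2M ∫₀ᵗ √Y` (for the continuous representative
`Y(t) = ‖θ₀‖² + 2∫₀ᵗ∫ s θ - 2κ∫₀ᵗ‖∇θ‖²_a` of `‖θ(t)‖²`) to `√Y(t) ≤ m + M t` is the elementary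
first-crossing argument `sqrt_le_add_mul_of_le_sq_add_integral` (no differentiability of `Y` is
used — only continuity and the inequality from the base point).

## Mathlib / tree search

Tree: `IsWeakScalarTransportDiagForcedOn.energy_eq`, `….integrableOn_integral_source_mul`,
`….integrableOn_toReal_eScalarGradNormSqDiag`, `….ae_memLp_two` (the T1 energy layer);
`Torus.sqrt_le_sqrt_add_integral_of_hasDerivWithinAt` (classical, derivative form — not usable for
weak solutions). Mathlib: `intervalIntegral.integral_mono_on_of_le_Ioo`, `IsClosed.csInf_mem`,
`intervalIntegral.continuousOn_primitive`.

## References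

* P. Bonicatto, G. Ciampa, G. Crippa, J. Math. Pures Appl. (2024) = arXiv:2306.15529, Thm. 3.3,
  (3.4), Remark 3.4 (energy balance as an equality for bounded drifts). [`BonicattoCiampaCrippa2023`]
* R. J. DiPerna, P.-L. Lions, Invent. Math. 98 (1989), §II.1, (13)–(14) (the `L^∞_t L²_x` a
  priori estimate). [`DiPernaLions1989`]
* I. Bihari, Acta Math. Acad. Sci. Hungar. 7 (1956) 81–94, Theorem 1 (the nonlinear integral
  inequality). [`Bihari1956`]
-/

noncomputable section

open _root_.MeasureTheory _root_.Set _root_.Filter _root_.Function _root_.TopologicalSpace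
open scoped ENNReal NNReal InnerProductSpace

namespace Literature.Analysis.FluidPDE

namespace Torus

open Literature.Analysis.FunctionSpaces.Torus Literature.Analysis.FunctionSpaces

variable {d : Type*} [Fintype d] [DecidableEq d]

/-! ## Tools -/

section Tools

omit [Fintype d] [DecidableEq d] in
/-- **First-crossing comparison lemma.** If `Y` is continuous on `[0,T]`, `m, M ≥ 0`, and
`Y(t) ≤ m² + 2M ∫₀ᵗ √(Y(τ)) dτ` for every `t ∈ [0,T]`, then `√(Y(t)) ≤ m + M t` on `[0,T]`.
(If `√Y` exceeded `m + Mτ + δ` for the first time at `τ₀ > 0`, integrating the bound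
`√Y ≤ m + Mτ + δ` on `[0,τ₀)` would give `Y(τ₀) ≤ (m + Mτ₀)² + 2Mδτ₀ < (m + Mτ₀ + δ)²`.) This is
the case `ω(u) = 2M√u`, `Ω(u) = √u / M` of Bihari's nonlinear integral inequality
(`u(t) ≤ k + ∫₀ᵗ ω(u) ⇒ u(t) ≤ Ω⁻¹(Ω(k) + t)`), proved here for a merely continuous `Y` and the
inequality from the base point only. [cite: Bihari1956, Theorem 1 (the case ω(u) = 2M√u)] -/
theorem sqrt_le_add_mul_of_le_sq_add_integral {Y : ℝ → ℝ} {T m M : ℝ} (hm : 0 ≤ m) (hM : 0 ≤ M)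
    (hY : ContinuousOn Y (Icc 0 T))
    (h : ∀ t ∈ Icc 0 T, Y t ≤ m ^ 2 + 2 * M * ∫ τ in (0 : ℝ)..t, Real.sqrt (Y τ)) :
    ∀ t ∈ Icc 0 T, Real.sqrt (Y t) ≤ m + M * t := by
  intro t ht
  by_contra hcon
  rw [not_le] at hcon
  -- the overshoot `δ > 0` and the (closed, nonempty) set where `√Y ≥ m + Mτ + δ`
  set δ : ℝ := Real.sqrt (Y t) - (m + M * t) with hδ
  have hδ0 : 0 < δ := by rw [hδ]; linarith
  set A : Set ℝ := Icc 0 t ∩ (fun τ => Real.sqrt (Y τ) - (m + M * τ + δ)) ⁻¹' Ici 0 with hA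
  have htT : Icc 0 t ⊆ Icc 0 T := Icc_subset_Icc le_rfl ht.2
  have hYt : ContinuousOn Y (Icc 0 t) := hY.mono htT
  have hcont : ContinuousOn (fun τ => Real.sqrt (Y τ) - (m + M * τ + δ)) (Icc 0 t) :=
    (Real.continuous_sqrt.comp_continuousOn hYt).sub (by fun_prop)
  have hAc : IsClosed A := hcont.preimage_isClosed_of_isClosed isClosed_Icc isClosed_Ici
  have htA : t ∈ A := ⟨⟨ht.1, le_rfl⟩, by simp [hδ]⟩
  have hAne : A.Nonempty := ⟨t, htA⟩
  have hAbdd : BddBelow A := ⟨0, fun τ hτ => hτ.1.1⟩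
  set τ₀ : ℝ := sInf A with hτ₀
  have hτ₀A : τ₀ ∈ A := hAc.csInf_mem hAne hAbdd
  have hτ₀t : τ₀ ∈ Icc 0 t := hτ₀A.1
  have hge : m + M * τ₀ + δ ≤ Real.sqrt (Y τ₀) := by
    have := hτ₀A.2
    simp only [mem_preimage, mem_Ici, sub_nonneg] at this
    exact this
  -- `τ₀ > 0`: at `τ = 0` the hypothesis gives `√Y(0) ≤ m < m + δ`
  have h0 : Real.sqrt (Y 0) ≤ m := by
    have := h 0 ⟨le_rfl, ht.1.trans ht.2⟩
    simp only [intervalIntegral.integral_same, mul_zero, add_zero] at this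
    calc Real.sqrt (Y 0) ≤ Real.sqrt (m ^ 2) := Real.sqrt_le_sqrt this
      _ = m := Real.sqrt_sq hm
  have hτ₀pos : 0 < τ₀ := by
    rcases hτ₀t.1.eq_or_lt with h0' | h0'
    · exfalso
      rw [← h0'] at hge
      simp only [mul_zero, add_zero] at hge
      linarith
    · exact h0'
  -- below `τ₀` the square root stays under `m + Mτ + δ`
  have hbelow : ∀ τ ∈ Ioo 0 τ₀, Real.sqrt (Y τ) ≤ m + M * τ + δ := by
    intro τ hτ
    by_contra hc
    rw [not_le] at hc
    have hτA : τ ∈ A := ⟨⟨hτ.1.le, hτ.2.le.trans hτ₀t.2⟩, by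
      simp only [mem_preimage, mem_Ici, sub_nonneg]; exact hc.le⟩
    have : τ₀ ≤ τ := csInf_le hAbdd hτA
    exact absurd this (not_le.2 hτ.2)
  -- integrate on `[0, τ₀]`
  have hsq_int : IntervalIntegrable (fun τ => Real.sqrt (Y τ)) volume 0 τ₀ :=
    ((Real.continuous_sqrt.comp_continuousOn hYt).mono
      (Icc_subset_Icc le_rfl hτ₀t.2)).intervalIntegrable_of_Icc hτ₀pos.le
  have hlin_int : IntervalIntegrable (fun τ => m + M * τ + δ) volume 0 τ₀ :=
    (by fun_prop : Continuous fun τ : ℝ => m + M * τ + δ).intervalIntegrable _ _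
  have hI : ∫ τ in (0 : ℝ)..τ₀, Real.sqrt (Y τ) ≤ ∫ τ in (0 : ℝ)..τ₀, (m + M * τ + δ) :=
    intervalIntegral.integral_mono_on_of_le_Ioo hτ₀pos.le hsq_int hlin_int hbelow
  have hlin : ∫ τ in (0 : ℝ)..τ₀, (m + M * τ + δ) = (m + δ) * τ₀ + M * τ₀ ^ 2 / 2 := by
    have e1 : (fun τ : ℝ => m + M * τ + δ) = fun τ => M * τ + (m + δ) := by
      funext τ; ring
    rw [e1, intervalIntegral.integral_add ((by fun_prop : Continuous fun τ : ℝ => M * τ).intervalIntegrable _ _)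
      (continuous_const.intervalIntegrable _ _), intervalIntegral.integral_const_mul, integral_id,
      intervalIntegral.integral_const]
    simp only [smul_eq_mul]
    ring
  have hYτ₀ : Y τ₀ ≤ (m + M * τ₀) ^ 2 + 2 * M * δ * τ₀ := by
    have h1 := h τ₀ (htT hτ₀t)
    have h2 : 2 * M * ∫ τ in (0 : ℝ)..τ₀, Real.sqrt (Y τ) ≤ 2 * M * ((m + δ) * τ₀ + M * τ₀ ^ 2 / 2) := by
      rw [← hlin]
      exact mul_le_mul_of_nonneg_left hI (by positivity)
    nlinarith
  -- but `Y(τ₀) ≥ (m + Mτ₀ + δ)²`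
  have hpos : 0 ≤ m + M * τ₀ + δ := by positivity
  have hYge : (m + M * τ₀ + δ) ^ 2 ≤ Y τ₀ := by
    have hs0 : 0 < Real.sqrt (Y τ₀) := lt_of_lt_of_le (by positivity) hge
    have hY0 : 0 < Y τ₀ := Real.sqrt_pos.1 hs0
    calc (m + M * τ₀ + δ) ^ 2 ≤ Real.sqrt (Y τ₀) ^ 2 := pow_le_pow_left₀ hpos hge 2
      _ = Y τ₀ := Real.sq_sqrt hY0.le
  nlinarith [mul_nonneg hM hτ₀pos.le]

omit [DecidableEq d] in
/-- Cauchy–Schwarz in `L²(T^d)`: `∫ f g ≤ √(∫ f²) √(∫ g²)`. [folklore] -/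
private theorem integral_mul_le_sqrt_mul_sqrt {f g : UnitAddTorus d → ℝ} (hf : MemLp f 2 volume)
    (hg : MemLp g 2 volume) :
    ∫ x, f x * g x ≤ Real.sqrt (∫ x, f x ^ 2) * Real.sqrt (∫ x, g x ^ 2) := by
  -- adapted from `Torus.DEIJ.abs_integral_mul_le_sqrt` (DEIJCriterion.lean)
  have hf' : MemLp f (ENNReal.ofReal 2) volume := by rwa [ENNReal.ofReal_ofNat]
  have hg' : MemLp g (ENNReal.ofReal 2) volume := by rwa [ENNReal.ofReal_ofNat]
  have h := integral_mul_norm_le_Lp_mul_Lq (μ := volume) Real.HolderConjugate.two_two hf' hg'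
  have e2 : ∀ (w : UnitAddTorus d → ℝ), (∫ a, ‖w a‖ ^ (2 : ℝ)) ^ (1 / (2 : ℝ)) = Real.sqrt (∫ a, w a ^ 2) := by
    intro w
    rw [Real.sqrt_eq_rpow]
    congr 1
    refine integral_congr_ae (Eventually.of_forall fun a => ?_)
    dsimp only
    rw [Real.rpow_two, Real.norm_eq_abs, sq_abs]
  rw [e2, e2] at h
  refine le_trans ?_ h
  calc ∫ x, f x * g x ≤ |∫ x, f x * g x| := le_abs_self _
    _ ≤ ∫ x, |f x * g x| := abs_integral_le_integral_abs
    _ = ∫ x, ‖f x‖ * ‖g x‖ := integral_congr_ae (Eventually.of_forall fun x => by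
        simp [abs_mul, Real.norm_eq_abs])

end Tools

/-! ## The growth bound -/

namespace IsWeakScalarTransportDiagForcedOn

variable {T κ : ℝ} {a : d → ℝ} {u : ℝ → UnitAddTorus d → EuclideanSpace ℝ d}
  {s : ℝ → UnitAddTorus d → ℝ} {θ₀ : UnitAddTorus d → ℝ} {θ : ℝ → UnitAddTorus d → ℝ}

omit [DecidableEq d] in
/-- An a.e. `L²` bound on the source slices gives the `L¹_t L²_x` finiteness the energy layer
asks for: `∫⁻_{(0,T)} (∫⁻ ‖s(t)‖ₑ²)^{1/2} ≤ M · T < ∞`. [folklore] -/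
private theorem lintegral_source_rpow_half_lt_top_of_ae_le {M : ℝ} (hM : 0 ≤ M)
    (hs2 : ∀ᵐ t ∂(volume.restrict (Ioo 0 T)), MemLp (s t) 2 volume)
    (hsM : ∀ᵐ t ∂(volume.restrict (Ioo 0 T)), ∫ x, s t x ^ 2 ≤ M ^ 2) :
    ∫⁻ t in Ioo 0 T, (∫⁻ x, ‖s t x‖ₑ ^ 2) ^ (1 / 2 : ℝ) < ⊤ := by
  have hle : ∀ᵐ t ∂(volume.restrict (Ioo 0 T)), (∫⁻ x, ‖s t x‖ₑ ^ 2) ^ (1 / 2 : ℝ) ≤ ENNReal.ofReal M := by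
    filter_upwards [hs2, hsM] with t ht htM
    have e : ∫⁻ x, ‖s t x‖ₑ ^ 2 = ENNReal.ofReal (∫ x, s t x ^ 2) := by
      rw [ofReal_integral_eq_lintegral_ofReal ht.integrable_sq (ae_of_all _ fun x => sq_nonneg _)]
      refine lintegral_congr fun x => ?_
      rw [Real.enorm_eq_ofReal_abs, ← ENNReal.ofReal_pow (abs_nonneg _), sq_abs]
    rw [e]
    calc ENNReal.ofReal (∫ x, s t x ^ 2) ^ (1 / 2 : ℝ) ≤ ENNReal.ofReal (M ^ 2) ^ (1 / 2 : ℝ) :=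
          ENNReal.rpow_le_rpow (ENNReal.ofReal_le_ofReal htM) (by norm_num)
      _ = ENNReal.ofReal M := by
          rw [ENNReal.ofReal_rpow_of_nonneg (sq_nonneg _) (by norm_num), ← Real.sqrt_eq_rpow,
            Real.sqrt_sq hM]
  calc ∫⁻ t in Ioo 0 T, (∫⁻ x, ‖s t x‖ₑ ^ 2) ^ (1 / 2 : ℝ)
      ≤ ∫⁻ _ in Ioo 0 T, ENNReal.ofReal M := lintegral_mono_ae hle
    _ < ⊤ := by
        rw [setLIntegral_const]
        exact ENNReal.mul_lt_top ENNReal.ofReal_lt_top (measure_Ioo_lt_top)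

/-- **Linear `L²` growth under an `L²`-bounded source.** For `κ > 0`, `aᵢ > 0`, `θ₀ ∈ L²(T^d)`,
a bounded drift `u ∈ L^∞((0,T) × T^d)` (weakly divergence free for a.e. `t`, part of the class)
and a source with `s(t) ∈ L²`, `‖s(t)‖²_{L²} ≤ M²` for a.e. `t ∈ (0,T)` (`M ≥ 0`), EVERY weak
solution `θ` of `∂ₜθ + u·∇θ = κ ∑ᵢ aᵢ ∂ᵢ∂ᵢθ + s` on `T^d × [0,T)` satisfies
`‖θ(t)‖_{L²} ≤ ‖θ₀‖_{L²} + M t` for a.e. `t ∈ (0,T)` — the `L^∞_t L²_x` a priori estimate of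
DiPerna–Lions 1989, §II.1 (13), for the class in which the energy balance is an equality
(Bonicatto–Ciampa–Crippa 2024, Thm. 3.3, Remark 3.4: `energy_eq`): drop the dissipation, bound the
work of the source by Cauchy–Schwarz, and compare (`sqrt_le_add_mul_of_le_sq_add_integral`).
[cite: BonicattoCiampaCrippa2023, Thm. 3.3, (3.4) and Remark 3.4] -/
theorem ae_sqrt_integral_sq_le (h : IsWeakScalarTransportDiagForcedOn T a κ u s θ₀ θ)
    (hκ : 0 < κ) (ha : ∀ i, 0 < a i) (hθ₀ : MemLp θ₀ 2 volume)
    (hu : MemLp (stLift u) ⊤ (volume.restrict (Ioo 0 T ×ˢ univ))) {M : ℝ} (hM : 0 ≤ M)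
    (hs2 : ∀ᵐ t ∂(volume.restrict (Ioo 0 T)), MemLp (s t) 2 volume)
    (hsM : ∀ᵐ t ∂(volume.restrict (Ioo 0 T)), ∫ x, s t x ^ 2 ≤ M ^ 2) :
    ∀ᵐ t ∂(volume.restrict (Ioo 0 T)),
      Real.sqrt (∫ x, θ t x ^ 2) ≤ Real.sqrt (∫ x, θ₀ x ^ 2) + M * t := by
  rcases le_or_gt T 0 with hT | hT
  · rw [Ioo_eq_empty_of_le hT, Measure.restrict_empty, ae_zero]
    exact Filter.eventually_bot
  have hs := lintegral_source_rpow_half_lt_top_of_ae_le (T := T) (s := s) hM hs2 hsM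
  have hE := h.energy_eq hκ ha hθ₀ hu hs
  obtain ⟨hg, hgt⟩ := h.integrableOn_toReal_eScalarGradNormSqDiag hκ ha hθ₀ hu hs
  have hsI := h.integrableOn_integral_source_mul hs
  -- the continuous representative of `‖θ(t)‖²`
  set m : ℝ := Real.sqrt (∫ x, θ₀ x ^ 2) with hm
  set W : ℝ → ℝ := fun τ => ∫ x, s τ x * θ τ x with hW
  set G : ℝ → ℝ := fun τ => (Torus.eScalarGradNormSqDiag a (θ τ)).toReal with hG
  set Y : ℝ → ℝ := fun t => m ^ 2 + 2 * (∫ τ in Ioc 0 t, W τ) - 2 * κ * ∫ τ in Ioc 0 t, G τ with hY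
  have hm2 : m ^ 2 = ∫ x, θ₀ x ^ 2 := Real.sq_sqrt (integral_nonneg fun x => sq_nonneg _)
  have hWI : IntegrableOn W (Icc 0 T) volume := hsI.congr_set_ae Ioo_ae_eq_Icc.symm
  have hGI : IntegrableOn G (Icc 0 T) volume := hg.congr_set_ae Ioo_ae_eq_Icc.symm
  have hYc : ContinuousOn Y (Icc 0 T) :=
    (continuousOn_const.add (continuousOn_const.mul (intervalIntegral.continuousOn_primitive hWI))).sub
      (continuousOn_const.mul (intervalIntegral.continuousOn_primitive hGI))
  -- `Y(t) = ‖θ(t)‖²` for a.e. `t`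
  have hYae : ∀ᵐ t ∂(volume.restrict (Ioo 0 T)), ∫ x, θ t x ^ 2 = Y t := by
    filter_upwards [hE, ae_restrict_mem measurableSet_Ioo] with t ht htT
    have e1 : ∫ τ in Ioc 0 t, W τ = ∫ τ in Ioo 0 t, W τ := setIntegral_congr_set Ioo_ae_eq_Ioc.symm
    have e2 : ∫ τ in Ioc 0 t, G τ = (∫⁻ τ in Ioo 0 t, Torus.eScalarGradNormSqDiag a (θ τ)).toReal := by
      rw [setIntegral_congr_set Ioo_ae_eq_Ioc.symm]
      exact hgt t htT.2.le
    simp only [hY, e1, e2, hm2]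
    linarith
  -- the work of the source is at most `M √Y` for a.e. `τ`
  have hWle : ∀ᵐ τ ∂(volume.restrict (Ioo 0 T)), W τ ≤ M * Real.sqrt (Y τ) := by
    filter_upwards [hYae, h.ae_memLp_two, hs2, hsM] with τ hτ hθτ hsτ hsMτ
    calc W τ ≤ Real.sqrt (∫ x, s τ x ^ 2) * Real.sqrt (∫ x, θ τ x ^ 2) :=
          integral_mul_le_sqrt_mul_sqrt hsτ hθτ
      _ ≤ M * Real.sqrt (Y τ) := by
          rw [hτ]
          refine mul_le_mul_of_nonneg_right ?_ (Real.sqrt_nonneg _)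
          calc Real.sqrt (∫ x, s τ x ^ 2) ≤ Real.sqrt (M ^ 2) := Real.sqrt_le_sqrt hsMτ
            _ = M := Real.sqrt_sq hM
  -- the integral inequality from the base point
  have hineq : ∀ t ∈ Icc 0 T, Y t ≤ m ^ 2 + 2 * M * ∫ τ in (0 : ℝ)..t, Real.sqrt (Y τ) := by
    intro t ht
    have hsub : Ioc 0 t ⊆ Icc 0 T := fun τ hτ => ⟨hτ.1.le, hτ.2.trans ht.2⟩
    have hGnn : 0 ≤ ∫ τ in Ioc 0 t, G τ :=
      setIntegral_nonneg measurableSet_Ioc fun τ _ => ENNReal.toReal_nonneg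
    have hsqI : IntegrableOn (fun τ => Real.sqrt (Y τ)) (Icc 0 T) volume :=
      (Real.continuous_sqrt.comp_continuousOn hYc).integrableOn_compact isCompact_Icc
    have hWmono : ∫ τ in Ioc 0 t, W τ ≤ ∫ τ in Ioc 0 t, M * Real.sqrt (Y τ) := by
      have hae : ∀ᵐ τ ∂(volume.restrict (Ioc 0 t)), W τ ≤ M * Real.sqrt (Y τ) := by
        rw [← Measure.restrict_congr_set Ioo_ae_eq_Ioc]
        exact ae_restrict_of_ae_restrict_of_subset (Ioo_subset_Ioo_right ht.2) hWle
      exact setIntegral_mono_ae_restrict (hWI.mono_set hsub) ((hsqI.mono_set hsub).const_mul M) hae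
    rw [intervalIntegral.integral_of_le ht.1]
    have hcm : ∫ τ in Ioc 0 t, M * Real.sqrt (Y τ) = M * ∫ τ in Ioc 0 t, Real.sqrt (Y τ) :=
      integral_const_mul _ _
    have : Y t = m ^ 2 + 2 * (∫ τ in Ioc 0 t, W τ) - 2 * κ * ∫ τ in Ioc 0 t, G τ := rfl
    rw [this]
    nlinarith [mul_nonneg hκ.le hGnn, hWmono, hcm]
  have key := sqrt_le_add_mul_of_le_sq_add_integral (Real.sqrt_nonneg _) hM hYc hineq
  filter_upwards [hYae, ae_restrict_mem measurableSet_Ioo] with t ht htT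
  rw [ht]
  exact key t ⟨htT.1.le, htT.2.le⟩

end IsWeakScalarTransportDiagForcedOn

end Torus

end Literature.Analysis.FluidPDE

end
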